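import Summits.Ventures.DiscreteObjects.Verify.DesignsKernel

/-!
# Kernel replay: an explicit self-orthogonal Latin square of order 10 (cell pub-namedobj, family SOLS, designs g2)
Framing: lottery ticket; floor = certified bounds/negative ranges.
`sols10` is the first class representative produced by the census engine E2 (DLX) in stage-1 case c3065
of order 10 (idempotent normal form: `L i i = i`); the kernel checks with verify-ref's `isMOLS` that
`sols10` and its transpose are Latin and orthogonal, i.e. that `sols10` is a SOLS(10). This reproduces
the classical existence of SOLS(10) (Brayton–Coppersmith–Hoffman 1974) on an explicit object; it is a
(+) control of the family, not a new result. Whether `{sols10, sols10ᵀ}` extends to three MOLS(10) is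
exactly the census question of the family (answered per class by the extension engines, not here).
-/

namespace Summit.Ventures.DiscreteObjects.Verify

/-- transpose of a square given as a list of rows (via verify-ref's `column`) -/
def transposeSq (L : List (List Nat)) : List (List Nat) := (List.range L.length).map (column L)

/-- an idempotent self-orthogonal Latin square of order 10 (census engine E2, case c3065, canonical form) -/
def sols10 : List (List Nat) := [[0, 2, 1, 4, 5, 3, 7, 9, 6, 8], [3, 1, 5, 7, 6, 9, 8, 4, 0, 2], [4, 6, 2, 5, 7, 8, 9, 1, 3, 0], [7, 0, 4, 3, 1, 2, 5, 8, 9, 6], [8, 3, 9, 6, 4, 0, 1, 2, 5, 7], [9, 4, 3, 0, 8, 5, 2, 6, 7, 1], [5, 7, 8, 9, 3, 1, 6, 0, 2, 4], [6, 8, 0, 2, 9, 4, 3, 7, 1, 5], [2, 9, 7, 1, 0, 6, 4, 5, 8, 3], [1, 5, 6, 8, 2, 7, 0, 3, 4, 9]]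

/-- control (+): `sols10` and its transpose are two MOLS(10), i.e. `sols10` is self-orthogonal (kernel `decide`). -/
theorem sols10_selfOrthogonal : isMOLS [sols10, transposeSq sols10] = true := by
  decide

/-- `sols10` is idempotent: its diagonal reads `0, 1, …, 9` (kernel `decide`). -/
theorem sols10_idempotent : ((List.range 10).map (fun i => (sols10.getD i []).getD i 10)) = List.range 10 := by
  decide

end Summit.Ventures.DiscreteObjects.Verify
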